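import Mathlib
import HarnessLib
import HarnessLib.Audit
import Summits.ValiantsHypothesis.Statement
import Literature.Computability.AlgebraicComplexity.BDS24PresentableBorder
import Literature.Computability.AlgebraicComplexity.GMQ16Question444Degree
import Literature.Computability.AlgebraicComplexity.GMQ16PDefinableDegenerations
import Literature.Computability.AlgebraicComplexity.BDS24ExponentialInterpolation
import Literature.Computability.AlgebraicComplexity.Bur24UnboundedDegreeTransfer
import Literature.Computability.AlgebraicComplexity.Bur24UnboundedDegreeClassesField
import Literature.Computability.AlgebraicComplexity.BLMW11KroneckerApproximation
import Literature.Computability.AlgebraicComplexity.Bur26CountingClassVCH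
import HarnessLib.Audit.Status.Attr

/-!
Route: VPBoundarySquare

# Route VPBoundarySquare — VP≠VNP ⟺ (VP closed ⟹ VNP ⊄ closure of VP) ∧ (VP=VNP ⟹ VP closed) — the
boundary-of-VP square (decomp lens-3 v5)

It suffices to show X = Q ∧ P, and S ⟺ X (kernel-checked `node_iff` in the lens draft
HOME/decomp-val-lens-3/VPBoundarySquare.lean). With VP̄ :=
"p-family with p-bounded border complexity" (`IsPFamily f ∧ IsVPBarFamily f`; BLMW 2011 Def. 9.3.1 +
the degree bound of Bürgisser 2024 Def. 4.23),
D := "VP is closed" (VP̄ ⊆ VP: every such family is p-computable), N := VNP ⊆ VP̄, M := ¬D ("the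
boundary of VP is non-empty", the [GCT5] conjecture
studied in GMQ16) and U := VP̄ ⊆ VNP (closure-definability, open): Q = `EmptyBoundarySeparates` := D
→ ¬N (⟺ S ∨ M) and P = `CollapseEmptiesBoundary`
:= VP=VNP → D (⟺ M → S). Both are consequences of S (`emptyBoundarySeparates_of_vh`,
`collapseEmptiesBoundary_of_vh`), Q ∨ P is a theorem (mutual
residuals), and the sufficient sandwich M → U → S is kernel-checked. P is the attacked conjunct
(roads U, D, GMQ16 programme; proved rung: the
polynomial-ORDER boundary of VP is empty); Q is the declared residual (road M).
Lean: `((∀ (v : ℕ → ℕ) (f : ∀ n, MvPolynomial (Fin (v n)) ℂ),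
Literature.Computability.AlgebraicComplexity.IsPFamily f →
Literature.Computability.AlgebraicComplexity.IsVPBarFamily f →
Literature.Computability.AlgebraicComplexity.IsPComputable f) → ¬ (∀ (v : ℕ → ℕ) (f : ∀ n,
MvPolynomial (Fin (v n)) ℂ), Literature.Computability.AlgebraicComplexity.IsVNPFamily f →
Literature.Computability.AlgebraicComplexity.IsVPBarFamily f)) ∧
(Literature.Computability.AlgebraicComplexity.VP ℂ =
Literature.Computability.AlgebraicComplexity.VNP ℂ → ∀ (v : ℕ → ℕ) (f : ∀ n, MvPolynomial (Fin (v
n)) ℂ), Literature.Computability.AlgebraicComplexity.IsPFamily f →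
Literature.Computability.AlgebraicComplexity.IsVPBarFamily f →
Literature.Computability.AlgebraicComplexity.IsPComputable f)`

## Assembly
Pure logic plus one inclusion: under VP = VNP, P gives D (VP closed); VNP = VP ⊆ closure(VP)
(`approxComplexity_le_complexity`) gives N; Q turns D into ¬N — contradiction (`closes h₁ h₂`, five
lines). Conversely S implies each piece (P trivially; Q via the VNP family per: `perFin`,
`not_vnp_subset_pComputable_of_vh`, tree `perNotPComputableComplex_iff_holds`), so S ⟺ Q ∧ P
(`node_iff`); Q ∨ P holds outright (`q_or_p`), (P → S) ↔ Q and (Q → S) ↔ P (`residual_of_P_iff`,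
`residual_of_Q_iff`).

Rationale: WHY THIS LINE. The decomp-valiant lens-3 lineage conditions the summit on the border axis; its node
of record (route DecompCycle1C, dial point closure(VP_ws)) was shown by
the lens's own axis lemma to carry its lower-bound piece as BARRIER at every dial point, so v5 sets
the dial at the TOP, closure(VP), where the bridge piece
is a theorem and the chasm piece "VP=VNP ⟹ VNP ⊆ closure(VP_ws)" disappears: what remains is the
S-weakening of two NAMED open problems of the border
literature — "is VP closed under approximation?" (the central GCT question: arXiv:2510.13049 p.5;
arXiv:1605.02815 p.3; arXiv:2406.06217 Def. 4.23 ff.)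
and "is closure(VP) ⊆ VNP?" (arXiv:1605.02815 p.3 "not even known"; programme VP ⊆ VP* ⊆ VNP, Thm 1
/ Cor 4.2 / Question 4.4(4)). The Dutta–Lysikov
dichotomy (if VP is closed, any separation proof shows VNP ⊄ closure(VP); if not, one must first
separate per from the boundary) is typed as an
⟺-split of S whose attacked half P has a printed road (U) with two PROVED rungs in the tree (GMQ16
Lemma 4.3 = `GMQ2016.lemma_4_3_holds`: poly-order
boundary empty; `GMQ2016.isVNPFamily_of_isDegenerationOfDegree`: poly-order degenerations of VNP
stay in VNP) in a regime where S itself is open.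
Imported area: orbit closures / one-parameter degenerations (GIT) via GMQ16. Versus the node of
record: the new residual Q is implied by 1C's
non-attackable pair (P1′ → P2 → Q, kernel) and not conversely (world VP=VNP ∧ M ∧ VNP ⊄
closure(VP_ws)), the attacked piece implies 1C's P3.

RANKED CRUXES. #2 CollapseEmptiesBoundary (crux) — P — under the collapse VP = VNP, VP is closed:
every p-family (p-bounded number of variables and degree) with p-bounded border (approximate)
circuit complexity is p-computable. Equivalently (M → S): a single p-family in the boundary of VP
already gives VP ≠ VNP. Implied by U = closure(VP) ⊆ VNP on p-families (`p_of_closureDefinable`), by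
D (`p_of_vpClosed`), by GMQ16 Thm 1(a) ∧ Question 4.4(4)
(`closureDefinable_of_thm_1a_star_of_question444'`); necessary (`collapseEmptiesBoundary_of_vh`).
Rung PROVED: poly-order boundary of VP is empty (`collapseEmptiesBoundary_rung_polyOrder` = GMQ16
Lemma 4.3). CAVEAT (workshop critic 21:53Z, LESSON 2): in the majority-belief world M (boundary of
VP non-empty, [GCT5]) P ≡ S and Q holds outright — so P is attacked ONLY through its named lever U =
ClosureDefinable (closure(VP) ⊆ VNP on p-families) and U's ladder, never 'in the abstract'; the node
is honestly the sufficient sandwich S ⟸ M ∧ U dressed as an ⟺-split. [difficulty: XL] (why it might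
fail: Mulmuley expects boundary points of non-closed orbits to lack succinct degeneration schemes
(GMQ16 §1.2, Question 4.4(4) open); if closure(VP) ⊄ VNP, P holds only because S does and the road U
is dead.) [arXiv:1605.02815, arXiv:2406.06217, arXiv:2510.13049, BurgisserEtAl2011]
#3 EmptyBoundarySeparates (crux) — Q (declared residual) — if VP is closed (every p-family with
p-bounded border complexity is p-computable) then VNP ⊄ closure(VP) (some VNP family has
superpolynomial border complexity). Equivalently S ∨ M: NOT the total collapse VP = VNP =
closure(VP)∩p-families. Implied by M = "boundary of VP non-empty" ([GCT5] conjecture;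
`q_of_boundaryNonempty`) and by 1C's pair P1′ ∧ P2 (`emptyBoundarySeparates_of_P1'_of_P2`);
necessary (`emptyBoundarySeparates_of_vh`, via the permanent). [difficulty: open-problem] (why it
might fail: irrefutable short of the total collapse VP=VNP=closure(VP); it fails to CLOSE: given its
hypothesis its content is a superpolynomial BORDER circuit lower bound for a VNP family
(natural-proofs / no-occurrence territory), and road M has no candidate family with a provable
circuit lower bound.) [arXiv:1605.02815, arXiv:2510.13049, BurgisserIkenmeyerPanova2019,
arXiv:2406.06217]
#9 ClosureDefinable (support) — U (road of P, banked; OPEN in print: "not even known if closure(VP)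
⊆ VNP", GMQ16 p.3) — every p-family with p-bounded border circuit complexity is in VNP. Implies P
(`p_of_closureDefinable`); with M implies S (`valiant_of_boundaryNonempty_of_closureDefinable`); not
known to imply S (compatible with VP = VNP = closure(VP)). [difficulty: open-problem]
[arXiv:1605.02815, arXiv:2406.06217]
#9 BoundaryOfVPNonempty (support) — M (road of Q, banked; the [GCT5] conjecture "closure(VP) ⊄ VP"
studied in GMQ16) — some p-family with p-bounded border circuit complexity is not p-computable.
Implies Q trivially; with U implies S; STRONGER than Q, not a piece. [difficulty: open-problem]
[arXiv:1605.02815, arXiv:2510.13049]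
#9 Question444PFamily (support) — GMQ16 Question 4.4(4) "closure(VP) = VP*?", faithful p-family
reading (banked): every p-family with p-bounded border complexity is a p-definable one-parameter
degeneration of a VP family. With GMQ16 Thm 1(a) (named fact `GMQ2016.thm_1a_star`) it gives U. (The
tree's degree-free rendering `GMQ2016.question_4_4_4` is refuted by x^(2^n): `not_question_4_4_4`,
proposal p746884.) [difficulty: open-problem] [arXiv:1605.02815]
#9 ValiantAtPolyOrder (support) — S-CASE of the BC5 rung's regime (banked, for the tribunal's T3
reading): Valiant's hypothesis restricted to polynomial approximation ORDER — some VNP family is not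
a polynomial-order one-parameter degeneration (GMQ16 §3.3) of a VP family on p-bounded variable
sets. It is implied by S through GMQ16 Lemma 4.3 (`valiantAtPolyOrder_of_vh` in the lens draft:
poly-order degenerations of VP are p-computable, and per is not) and implies S because every VP
family is an order-0 degeneration of itself (GMQ16 §1.1 chain VP ⊆ VP*), hence it is EQUIVALENT to S
and NOT a theorem: the proved rung (poly-order boundary of VP is empty, `GMQ2016.lemma_4_3_holds`)
therefore lies outside S's known regime. [difficulty: open-problem] [arXiv:1605.02815]

TWO-LAYER PLAN. P — registered-shape birth skeleton (bc/births_v5.lean, rc 0, sorries = stubs):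
GMQ16 programme line `stub_question444_pFamily` (closure(VP) ⊆ VP* on p-families, Question 4.4(4)) +
`stub_vpStar_subset_vnp` (VP* ⊆ VNP = GMQ16 Cor 4.2, in the tree only modulo the named fact Thm
1(a): formalise Valiant's criterion for p-definable degenerations) → `CollapseEmptiesBoundary_of`;
foreseen split of P once U's ladder moves: by approximation ORDER (poly-order PROVED,
`collapseEmptiesBoundary_rung_polyOrder`; exp-order = the crux) or by model below VP (1C's P3 =
closure(VP_ws) shadow, with its R2 PROVED / R3 typed ladder,
`collapseDebordersIntoCircuits_of_collapseEmptiesBoundary`). Q — line (i) road M (one statement,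
IDEA-NEEDED: an explicit boundary family with a circuit lower bound; GCT5 / NNL candidates), line
(ii) 1C's pair `stub_circuitDeborderedMS` ∧ `stub_collapseToBorderDet` → `EmptyBoundarySeparates_of`
(kernel: the old residual implies the new).

KILL CRITERIA. Refuting P or Q refutes S itself (both are S-implied), so no single refutation closes
the route; it is closed `exhausted` if U (closure(VP) ⊆ VNP) is REFUTED in print or in the tree (an
explicit p-family in closure(VP) outside VNP — which would also prove M and make Q a theorem, pivot:
the route then reads S ⟸ P alone with P ⟺ S, i.e. dead as a decomposition) and no collapse-powered
mechanism for P appears within tenure. Proved elsewhere: M makes Q a theorem and P ⟺ S (pivot to U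
as the whole summit road: M ∧ U ⊢ S); D (VP closed) makes P a theorem and Q ⟺ S ⟺ VNP ⊄ closure(VP)
(pivot to border lower bounds, GCT routes).

NOT DECOMPOSED YET. The exp-order layer of P (p-definable degenerations of exponential order: GMQ16
Thm 1(a) typed as the named fact `thm_1a_star`, and Question 4.4(4)); the NNL /
explicit-boundary-family layer under road M; the circuits-vs-ABP de-bordering surplus of P over 1C's
P3. All are layer-2 children, filed when a rung closes or the critic asks.

CHEAPEST FALSIFIER. Lookup: is "closure(VP) ⊄ VNP" (¬U, kills P's road), "closure(VP) ⊄ VP" (M,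
moots Q) or "VP = VNP ⟹ VP closed" a theorem in print? Searched 2026-08-29 corpus (fts + hybrid +
vec) and galaxy: no — arXiv:1605.02815 p.3 and arXiv:2510.13049 p.5 state VP vs closure(VP) and
closure(VP) vs VNP as open; arXiv:2406.06217 p.21 "open question whether closure(VP) is strictly
larger than VP". In-tree: BC7 `#h21_crux_probe` on both pieces CLEAN (C → S fired for neither; S → C
fires for P = necessity); `ledger negatives --problem ValiantsHypothesis` has no closure-class
statement; the tree's `GMQ2016.question_4_4_4` was found REFUTABLE as typed (degree bound missing)
and is not used.

NUMBERS. closure(Σ^[k]ΠΣ) ⊆ VBP with ABP size s^{O(k·7^k)} (DuttaDwivediSaxena2021 Thm 1.1; tree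
`DDS2021_thm_3_2_holds` PROVED) — the explicit de-bordering ceiling; closure(VP_2) = closure(VF) ⊋
VBP_2 (BringmannIkenmeyerZuiddam2018) — approximation is necessary at width 2; border dc(per_m) ≥
m²/2 (LandsbergManivelRessayre2013); GCT occurrence no-go m ≥ n^25 (BurgisserIkenmeyerPanova2019);
poly-order degenerations: deg-K one-parameter limits of size-s circuits have circuits of size O(K²
s) (GMQ16 Lemma 4.3 / Bürgisser 2004 interpolation; tree `GMQ2016.lemma_4_3_holds`).

DEFINITION REQUESTS. None new: VP*, VNP*, p-definable degenerations landed (p742676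
`GMQ16PDefinableDegenerations`); correction of the degree-free `question_4_4_4` proposed (p746884
`GMQ16Question444Degree`: `not_question_4_4_4`, `question_4_4_4_pFamily`). Cite fact already named:
`GMQ2016.thm_1a_star` (VNP* ⊆ VNP).

Novelty: Searches (2026-08-29): lit search --hybrid "closure of VP contained in VNP boundary of VP not
closed" (8 docs; hit 1 = GMQ16 galaxy-pdf-1561796166617785780 p.12, rest noise); lit vsearch "if VP
equals its Zariski closure then separating VNP from the closure of VP is the same as VP different
from VNP" (8, BCS97 pp.578–579 nearest, none on point); lit search '"closure of VP" VNP contained'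
(3: arxiv-1605.02815 p.3, doi-10-1145-3618260-3649743 p.4, galaxy GMQ16 p.12); lit galaxy search
"Boundaries of VP|closure of the class VP|VNP is closed" --star pdf (8: GMQ16 ICALP
pdf:-1561796166617785780, Forbes–Shpilka PSPACE hitting sets pdf:4843841702478899120, AGS
bootstrapping, Chatterjee–Gajjar–Tengse monotone classes beyond VNP); lit galaxy search "closure of
VP|boundary of VP|VP is closed" --star pdf (10, all noise); lit read arxiv:2510.13049 --grep closed
(p.5 L5 central question VP = closure(VP); p.19 L53 chain); lit read arxiv:2406.06217 p.21 (Def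
4.23, open question, approximation order); rg over
Summits/ValiantsHypothesis/ValiantsHypothesis/Theses for IsVPBarFamily / IsPFamily-closure items
(only DecompCycle1C's closure(VP_ws) items and WsBorderSandwich; no route types closure(VP) ⊆ VNP or
VP closed).
Nearest prior art found: arXiv:2510.13049 p.5 (Dutta–Lysikov 2025: the prose dichotomy "if VP =
closure(VP) any VP≠VNP proof gives VNP ⊄ closure(VP); if not, one must first separate per from
closure(VP)"); arXiv:1605.02815 (GMQ16: p.3 the two open inclusions, p.5 footnote "separat  [refs: 2510.13049, 2406.06217, 1605.02815, arxiv-1605.02815, doi-10-1145-3618260-3649743, arxiv:2510.13049, arxiv:2406.06217]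

Barriers (technique_class: closure-classes, collapse-propagation, debordering): - technique_class: closure-classes, collapse-propagation, debordering
- Literature.Barriers.ValiantsHypothesis.AlgebraicNaturalProofs: bites a rank-method proof of Q's
exact content given its hypothesis (a superpolynomial border-circuit lower bound for a VNP family;
FSV18 / KRST, VNP-natural proofs); Q is the declared residual. P is an implication FROM the collapse
and its road U is an UPPER-bound / definability statement (succinct degenerations), outside the
natural-proofs class.
- Literature.Barriers.ValiantsHypothesis.GCTOccurrenceObstructions: BIP19 no-occurrence bites only a
GCT proof of VNP ⊄ closure(VP) (Q's content under D); P uses no obstructions. (Uncatalogued but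
relevant, recorded here: BDGIL24 border-class invariance I(closure C) = I(C) — equations cannot see
the boundary of VP, so road M can never be certified by equations and the line does not try to, P's
engine being constructive de-bordering / p-definable degenerations; CKRST20 approximative hardness
is conditional and consistent with the line.)
- Negatives index: none of the refuted ValiantsHypothesis statements concerns closure classes /
IsVPBarFamily / IsPFamily de-bordering (ledger negatives checked 2026-08-29); the one refutable
statement met while typing (tree `GMQ2016.question_4_4_4`, degree-free) is NOT used — the faithful
`Question444PFamily` is banked instead.

History (route lifecycle, newest last):
- 2026-08-30T00:31:09Z · rev 4: informal re-worded for CollapseDebordersPresentable (planner-decomp-val-lens-3-g6-0)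
- 2026-08-30T01:49:38Z · rev 5: dropped Question444PFamily — decomp lens-3 g7: free an item slot (cap 15) for the v8 completion-ladder asides; Question444PFamily (GMQ16 Q4.44 p-family form) was an unstaffed aside banked i (planner-decomp-val-lens-3-g7-0)
- 2026-08-30T01:59:44Z · rev 6: dropped ValiantAtPolyOrder — decomp lens-3 g7: free the second slot (cap 15) for the v8 completion-ladder asides NbClosureDefinable / CHClosureDefinable; ValiantAtPolyOrder (VH at polynomia (planner-decomp-val-lens-3-g7-0)
- 2026-08-31T00:14:41Z · RESIDUAL declared: EmptyBoundarySeparates (stmt-ValiantsHypothesis-23843) — summit-strength until shown otherwise: tribunal_fit.residual verbatim. Q := (VP closed in pfam => VNP not in closure of VP) satisfies Q <=> S v M (Theorems.VPB (planner-decomp-val-lens-3-g37-0)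

sub-problem: ValiantsHypothesis · status: draft · opened planner-decomp-val-lens-3-g4-0 2026-08-29T22:18:06Z · rev 9 · ledger route-ValiantsHypothesis-VPBoundarySquare
GENERATED by the gate from the ledger (D-0016/17). Provers cite these decls: `theorem foo : Summit.ValiantsHypothesis.ValiantsHypothesis.Theses.VPBoundarySquare.<Decl> := …` in Summits/ValiantsHypothesis/ValiantsHypothesis/Theorems/<Name>.lean.
-/

namespace Summit.ValiantsHypothesis.ValiantsHypothesis.Theses.VPBoundarySquare

open scoped BigOperators Topology Manifold Classical MeasureTheory ProbabilityTheory Matrix InnerProductSpace ComplexConjugate ContinuousMap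
open Filter Set Function TopologicalSpace MeasureTheory

attribute [summit_statement] _root_.ValiantsHypothesis

open Literature.PNP

/-- item stmt-ValiantsHypothesis-23842 · crux · rank 2 · SPLIT (gen 1) into CollapseDebordersPresentable, PresentableCompletion + glue CollapseEmptiesBoundaryOfPresentable · direct attempts still welcome (low priority) · by planner
why it might fail: Mulmuley expects boundary points of non-closed orbits to lack succinct degeneration schemes (GMQ16 §1.2, Question 4.4(4) open); if closure(VP) ⊄ VNP, P holds only because S does and the road U is dead.
sources: arXiv:1605.02815, arXiv:2406.06217, arXiv:2510.13049, BurgisserEtAl2011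
[crux] P — under the collapse VP = VNP, VP is closed: every p-family (p-bounded number of variables
and degree) with p-bounded border (approximate) circuit complexity is p-computable. Equivalently (M
→ S): a single p-family in the boundary of VP already gives VP ≠ VNP. Implied by U = closure(VP) ⊆
VNP on p-families (`p_of_closureDefinable`), by D (`p_of_vpClosed`), by GMQ16 Thm 1(a) ∧ Question
4.4(4) (`closureDefinable_of_thm_1a_star_of_question444'`); necessary
(`collapseEmptiesBoundary_of_vh`). Rung PROVED: poly-order boundary of VP is empty
(`collapseEmptiesBoundary_rung_polyOrder` = GMQ16 Lemma 4.3). CAVEAT (workshop critic 21:53Z, LESSON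
2): in the majority-belief world M (boundary of VP non-empty, [GCT5]) P ≡ S and Q holds outright —
so P is attacked ONLY through its named lever U = ClosureDefinable (closure(VP) ⊆ VNP on p-families)
and U's ladder, never 'in the abstract'; the node is honestly the sufficient sandwich S ⟸ M ∧ U
dressed as an ⟺-split. [difficulty: XL] -/
@[route_item "route-ValiantsHypothesis-VPBoundarySquare", crux]
def CollapseEmptiesBoundary : Prop :=
  Literature.Computability.AlgebraicComplexity.VP ℂ = Literature.Computability.AlgebraicComplexity.VNP ℂ → ∀ (v : ℕ → ℕ) (f : ∀ n, MvPolynomial (Fin (v n)) ℂ), Literature.Computability.AlgebraicComplexity.IsPFamily f → Literature.Computability.AlgebraicComplexity.IsVPBarFamily f → Literature.Computability.AlgebraicComplexity.IsPComputable f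

-- parent: CollapseEmptiesBoundary · child (gen 1)
/--     item stmt-ValiantsHypothesis-23458 · crux · rank 201 · open
    parent: CollapseEmptiesBoundary · by planner
    why it might fail: ≡ S in the world M_ε (presentable boundary non-empty); its only road U_ε (VP̄_ε ⊆ VNP) is open over ℂ: BDS24's interpolation needs doubly-exponential integers outside finite fields (§6)
    sources: BhargavDwivediSaxena2024, §1.2 (p.5), Lemma 4.2, arXiv:2406.06217, Def. 4.23
[crux · child P_ε of the split of P = CollapseEmptiesBoundary (decomp lens-3 v6/v7; CAVEAT 1′
carried: S-implied like P, attack ONLY via U_ε or via the collapse)] under VP = VNP every p-family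
on Fin (v n) with p-bounded PRESENTABLE border complexity (Bhargav–Dwivedi–Saxena STOC 2024 Def.
4.3: approximant G(x,ε) = ε^M f + ε^{M+1} S of p-bounded circuit size with ε an input; tree
`IsPresVPBarFamily`) is p-computable. v7 STATUS — A THEOREM MODULO GRH AND ONE NAMED 2024 FACT:
`collapseDebordersPresentable_of_ERH : ExtendedRiemannHypothesis → Bur24_thm_4_10_2 ℂ →
CollapseDebordersPresentable` (Theorems/VPBoundarySquareNbTransfer; aside
CollapseDebordersPresentableOfGRH), by the chain VP̄_ε ∩ p-fam ⊆ VNPnb^ℂ (THEOREM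
`IsPresVPBarFamily.isVNPnbFamily` = BDS24 Lemma 4.1 'exponential interpolation at roots of unity' in
characteristic zero, Literature/…/BDS24ExponentialInterpolation) ⊆ VPnb (Bürgisser 2024 Thm 4.10(2):
char 0 + GRH + VP = VNP ⟹ VNPnb ⊆ VPnb; named fact `Bur24_thm_4_10_2`,
Literature/…/Bur24UnboundedDegreeTransfer) and VPnb ∩ p-fam = VP. UNCONDITIONALLY OPEN: implied by
U_ε = ClosureDefinablePres (`collapseDebordersPresentable_of_closureDefinablePres`) and by B_nb =
BooleanN -/
@[route_item "route-ValiantsHypothesis-VPBoundarySquare"]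
def CollapseDebordersPresentable : Prop :=
  Literature.Computability.AlgebraicComplexity.VP ℂ = Literature.Computability.AlgebraicComplexity.VNP ℂ → ∀ (v : ℕ → ℕ) (f : ∀ n, MvPolynomial (Fin (v n)) ℂ), Literature.Computability.AlgebraicComplexity.IsPFamily f → Literature.Computability.AlgebraicComplexity.IsPresVPBarFamily f → Literature.Computability.AlgebraicComplexity.IsPComputable f

-- parent: CollapseEmptiesBoundary · child (gen 1)
/--     item stmt-ValiantsHypothesis-23459 · crux · rank 202 · open
    parent: CollapseEmptiesBoundary · by planner
    why it might fail: generic points of ∂VP may need approximation order exp(n) with ε-constants of exponential circuit size over ℂ; Bürgisser 2004's order bound is existential and BDS24 leave VP̄ vs VP̄_ε open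
    sources: BhargavDwivediSaxena2024, §1.2 (p.5), arXiv:1605.02815, Question 4.4(4), Burgisser2004Factors, Thm. 5.7
[crux · THEOREM-INPUT·UNDECIDED·IDEA-NEEDED — completion child of the sanctioned glued split P ⟸
PresentableCompletion ∧ CollapseDebordersPresentable (decomp lens-3 v6; critic CLEARED
2026-08-29T23:09:14Z)] every p-family in the closure of VP is PRESENTABLY approximable: p-bounded
border complexity ⟹ p-bounded presentable border complexity (Bhargav–Dwivedi–Saxena 2024 Def. 4.3:
an approximant g(x,ε) = ε^M f + ε^{M+1} S of p-bounded circuit size over ℂ with ε an input, order M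
unrestricted; tree `presBorderComplexity`, `IsPresVPBarFamily`), i.e. VP̄ = VP̄_ε on p-families. NOT
S-implied (a structural statement about approximations, BDS24's own open question: 'VP ⊆ VP̄_ε ⊆ VP̄
raises new questions', §1.2); the presentability analogue of GMQ16 Question 4.4(4) (presentable and
VP* are incomparable as defined, BDS24 p.5). Kernel (lens draft VPBoundarySquareULadder.lean):
PresentableCompletion → CollapseDebordersPresentable → CollapseEmptiesBoundary and
PresentableCompletion → ClosureDefinablePres → ClosureDefinable; holds under the total collapse VP =
VNP = VP̄ (floor certificate). KILL CRITERION: a border point (p-family in VP̄) with provably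
NON-presentable approximations — every appro -/
@[route_item "route-ValiantsHypothesis-VPBoundarySquare", crux (bottleneck := idea) (source := "ledger D-0171 leaf tag IDEA-NEEDED on stmt-ValiantsHypothesis-23459, 2026-09-01")]
def PresentableCompletion : Prop :=
  ∀ (v : ℕ → ℕ) (f : ∀ n, MvPolynomial (Fin (v n)) ℂ), Literature.Computability.AlgebraicComplexity.IsPFamily f → Literature.Computability.AlgebraicComplexity.IsVPBarFamily f → Literature.Computability.AlgebraicComplexity.IsPresVPBarFamily f

-- parent: CollapseEmptiesBoundary · glue (gen 1)
/--     item stmt-ValiantsHypothesis-23460 · support · rank 203 · closed · proved by Summit.ValiantsHypothesis.ValiantsHypothesis.Theorems.VPBoundarySquarePresentableSplit.collapseEmptiesBoundaryOfPresentable_holds (planner)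
    parent: CollapseEmptiesBoundary · GLUE: children ⟹ parent · by planner
PresentableCompletion → CollapseDebordersPresentable → CollapseEmptiesBoundary: if every p-family in
VP̄ is presentably approximable (VP̄ ⊆ VP̄_ε) and the collapse VP = VNP de-borders the presentable
closure (VP̄_ε ⊆ VP), then the collapse closes VP (VP̄ ⊆ VP). Pure composition; kernel proof in
HOME/decomp-val-lens-3/VPBoundarySquareULadder.lean  (one line: fun hC hP hEq v f hpf hbar => hP hEq
v f hpf (hC v f hpf hbar)). -/
@[route_item "route-ValiantsHypothesis-VPBoundarySquare"]
def CollapseEmptiesBoundaryOfPresentable : Prop :=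
  CollapseDebordersPresentable → PresentableCompletion → CollapseEmptiesBoundary

-- `CollapseEmptiesBoundaryOfPresentable` holds: proved by `Summit.ValiantsHypothesis.ValiantsHypothesis.Theorems.VPBoundarySquarePresentableSplit.collapseEmptiesBoundaryOfPresentable_holds` (its module imports this route file, so no `_holds` link can be stated here).

/-- item stmt-ValiantsHypothesis-23843 · crux · RESIDUAL (gen 0; summit-strength until shown otherwise, D-0170) · rank 3 · open · by planner
why it might fail: irrefutable short of the total collapse VP=VNP=closure(VP); it fails to CLOSE: given its hypothesis its content is a superpolynomial BORDER circuit lower bound for a VNP family (natural-proofs / no-occurrence territory), and road M has no candidate family with a provable circuit lower bound.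
sources: arXiv:1605.02815, arXiv:2510.13049, BurgisserIkenmeyerPanova2019, arXiv:2406.06217
[crux] Q (declared residual) — if VP is closed (every p-family with p-bounded border complexity is
p-computable) then VNP ⊄ closure(VP) (some VNP family has superpolynomial border complexity).
Equivalently S ∨ M: NOT the total collapse VP = VNP = closure(VP)∩p-families. Implied by M =
"boundary of VP non-empty" ([GCT5] conjecture; `q_of_boundaryNonempty`) and by 1C's pair P1′ ∧ P2
(`emptyBoundarySeparates_of_P1'_of_P2`); necessary (`emptyBoundarySeparates_of_vh`, via the
permanent). [difficulty: open-problem] -/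
@[route_item "route-ValiantsHypothesis-VPBoundarySquare", crux (bottleneck := idea) (source := "ledger wanted_by.residual on stmt-ValiantsHypothesis-23843, 2026-09-01")]
def EmptyBoundarySeparates : Prop :=
  (∀ (v : ℕ → ℕ) (f : ∀ n, MvPolynomial (Fin (v n)) ℂ), Literature.Computability.AlgebraicComplexity.IsPFamily f → Literature.Computability.AlgebraicComplexity.IsVPBarFamily f → Literature.Computability.AlgebraicComplexity.IsPComputable f) → ¬ (∀ (v : ℕ → ℕ) (f : ∀ n, MvPolynomial (Fin (v n)) ℂ), Literature.Computability.AlgebraicComplexity.IsVNPFamily f → Literature.Computability.AlgebraicComplexity.IsVPBarFamily f)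

/-- item stmt-ValiantsHypothesis-23449 · aside · rank 9 · open · by planner
sources: BhargavDwivediSaxena2024, Def. 4.3, Thm. 1.3, §6, arXiv:2510.13049, Def. 48–49, Thm. 50, arXiv:1605.02815, p.3
[aside · rung U_ε of U = ClosureDefinable's ladder (decomp lens-3 v6, critic ask w1: the first rung
of closure(VP) ⊆ VNP beyond polynomial approximation order)] the PRESENTABLE closure of VP is
p-definable: every p-family on Fin (v n) with p-bounded presentable border complexity
(Bhargav–Dwivedi–Saxena STOC 2024 Def. 4.3: an approximant g(x,ε) = ε^M f + ε^{M+1} S of p-bounded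
circuit size over ℂ with ε an INPUT, approximation order M unrestricted; tree
`presBorderComplexity`, `IsPresVPBarFamily`, landed p749431) is in VNP — literally the tree
statement `PresVPBarSubsetVNP ℂ`. VP ⊆ VP̄_ε ⊆ VP̄ (`presBorderComplexity_le_complexity`,
`IsPresVPBarFamily.isVPBarFamily`), so U → U_ε (lens draft
`closureDefinablePres_of_closureDefinable`) and U_ε → P_ε. THEOREM over every finite field (BDS24
Thm 1.3 'presentable is explicit', named fact `BDS2024_thm_1_3`;
`presVPBarSubsetVNP_of_presVNPBarSubsetVNP`) where S is open — the sibling-setting witness; OPEN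
over ℚ and ℂ (BDS24 §6 p.16: the finite-field proof simulates F_{q^m}-arithmetic Booleanly, Lemma
4.2, and over ℚ the interpolation constants are doubly exponential). Holds under the total collapse
VP=VNP=VP̄ (floor certificate `residual_floo -/
@[route_item "route-ValiantsHypothesis-VPBoundarySquare", crux]
def ClosureDefinablePres : Prop :=
  Literature.Computability.AlgebraicComplexity.PresVPBarSubsetVNP ℂ

/-- item stmt-ValiantsHypothesis-23450 · aside · rank 9 · open · by planner
sources: Burgisser2004Factors, Thm. 1.3, BhargavDwivediSaxena2024, Lemma 4.4, Cor. 1.5, arXiv:2406.06217, Thm. 4.22 and p.21, Burgisser2000, Conj. 8.3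
[aside · bottom rung U_root of U's ladder (decomp lens-3 v6; the Factor-Conjecture face)] p-DEGREE
ROOTS OF p-SIZE CIRCUITS OF ARBITRARY DEGREE ARE p-DEFINABLE: if H_n(x, y) ≠ 0 has p-bounded circuit
complexity (degree unrestricted) and φ_n is a p-family (p-bounded variables and degree) with H_n(x,
φ_n(x)) = 0, then (φ_n) ∈ VNP. By Bürgisser 2004 Thm 1.3 (tree, PROVED:
`borderComplexity_le_of_isRoot`; lens draft `isVPBarFamily_of_isRootFamily`) such roots lie in VP̄,
so U → U_root (`rootsDefinable_of_closureDefinable`); U_ε → U_root modulo BDS24 Lemma 4.4 (roots are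
even presentable; support `RootsPresentable`, provable by adapting the tree's Newton construction
`exists_polyOrdGE_of_isRoot`). WEAKER than the Factor Conjecture (Bürgisser 2000 Conj. 8.3, root
form `RootsComputable`: roots p-COMPUTABLE; open, Bürgisser 2024 p.21, DSS22 partial). Over finite
fields (separable case) a theorem: BDS24 Cor 1.5. Open over ℂ as far as searched (corpus
fts+hybrid+vec and galaxy 2026-08-29: CKS19 closes VNP under factors of p-bounded DEGREE polynomials
only; Kaltofen needs deg H p-bounded). Technology: Newton/Hensel lifting + Valiant's criterion.
Holds under the total collapse. [difficulty: op -/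
@[route_item "route-ValiantsHypothesis-VPBoundarySquare", crux]
def RootsDefinable : Prop :=
  ∀ (v : ℕ → ℕ) (φ : ∀ n, MvPolynomial (Fin (v n)) ℂ) (H : ∀ n, MvPolynomial (Option (Fin (v n))) ℂ), (∀ n, H n ≠ 0 ∧ MvPolynomial.bind₁ (fun o : Option (Fin (v n)) => o.elim (φ n) MvPolynomial.X) (H n) = 0) → Literature.Computability.AlgebraicComplexity.IsPComputable H → Literature.Computability.AlgebraicComplexity.IsPFamily φ → Literature.Computability.AlgebraicComplexity.IsVNPFamily φ

/-- item stmt-ValiantsHypothesis-23451 · aside · rank 9 · open · by planner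
sources: arXiv:2406.06217, Thm. 3.2, Thm. 4.22, p.21, Burgisser2004Factors, Thm. 1.3, BhargavDwivediSaxena2024, §6 (p.16)
[aside · bottom rung P_root of the attacked piece P (decomp lens-3 v6)] under VP = VNP the Factor
Conjecture (root form) holds: p-degree roots φ_n of nonzero p-size circuits H_n(x, y) of arbitrary
degree are p-computable. WEAKER than P (`collapseComputesRoots_of_collapseEmptiesBoundary`, roots
are in VP̄ by Bürgisser 2004) and implied by U_root (`collapseComputesRoots_of_rootsDefinable`);
S-implied like P. PROVED degree-bounded rung: Kaltofen (tree `kaltofenFactorBound_complex`,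
`KaltofenFactor.complexity_le_of_dvd_charZero`: factors of p-size p-DEGREE circuits are p-size,
unconditionally). The dichotomy `rootsComputable_or_boundary` (lens draft): either the Factor
Conjecture's root form holds (then P_root and U_root are theorems) or a root family is an explicit
point of the boundary of VP (M, `boundaryOfVPNonempty_of_not_rootsComputable`) and the residual Q is
a theorem — the cheapest typed candidate shape for M (critic ask w2; BDS24 §6: 'could the permanent
be a factor of a small exponential-degree circuit?'). [difficulty: XL] -/
@[route_item "route-ValiantsHypothesis-VPBoundarySquare"]
def CollapseComputesRoots : Prop :=
  Literature.Computability.AlgebraicComplexity.VP ℂ = Literature.Computability.AlgebraicComplexity.VNP ℂ → ∀ (v : ℕ → ℕ) (φ : ∀ n, MvPolynomial (Fin (v n)) ℂ) (H : ∀ n, MvPolynomial (Option (Fin (v n))) ℂ), (∀ n, H n ≠ 0 ∧ MvPolynomial.bind₁ (fun o : Option (Fin (v n)) => o.elim (φ n) MvPolynomial.X) (H n) = 0) → Literature.Computability.AlgebraicComplexity.IsPComputable H → Literature.Computability.AlgebraicComplexity.IsPFamily φ → Literature.Computability.AlgebraicComplexity.IsPComputable φ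

/-- item stmt-ValiantsHypothesis-23487 · aside · rank 9 · open · by planner
sources: BhargavDwivediSaxena2024, Lemma 4.1 (p.13), Thm. 1.3, §6 (p.16), arXiv:2406.06217, §4.2, Cor. 4.7, Rem. 4.9, Thm. 4.10, arXiv:2510.13049, §3.4 Def. 48–49
[aside · rung B_nb of U's ladder, between U_ε and its GRH-collapse (decomp lens-3 v7 «NB-TRANSFER»)]
p-bounded Boolean sums Σ_{e∈{0,1}^{u(n)}} g_n(x,e) of p-size circuits g_n of UNBOUNDED degree
(Bürgisser 2024 §4.2: the class VNPnb^ℂ, tree `IsVNPnbFamily`) whose values f_n form a p-FAMILY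
(p-bounded number of variables and degree) are p-definable: VNPnb^ℂ ∩ {p-families} ⊆ VNP^ℂ —
literally the tree statement `VNPnbPFamSubsetVNP ℂ` (Literature/…/BDS24ExponentialInterpolation,
p751795). ARROWS (tree theorems, g6): B_nb → U_ε = ClosureDefinablePres
(`presVPBarSubsetVNP_of_vnpnbPFamSubsetVNP`, through the landed exponential interpolation at 2^t-th
roots of unity `IsPresVPBarFamily.isVNPnbFamily`: VP̄_ε ∩ p-fam ⊆ VNPnb^ℂ = BDS24 Lemma 4.1 in
characteristic zero — the coefficient of ε^M of a presentation G(x,ε) is (1/N) Σ_{i<N} ω^{(N−M)i}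
G(x,ω^i), a Boolean sum over {0,1}^t of ONE circuit of size ≤ 7·size(G)+8 and exponential degree);
U_ε^Σ = PresVNPBarSubsetVNP ℂ → B_nb (`vnpnbPFamSubsetVNP_of_presVNPBarSubsetVNP`: VNPnb ⊆ VNP̄_ε
with order 0); GRH ∧ Bürgisser 2024 Thm 4.10(2) ∧ VP = VNP ⟹ B_nb
(`booleanNbDefinable_of_ERH_of_collapse`: VNPnb ∩ p-fam ⊆ VPnb ∩ p-fam = VP ⊆ VNP), whence -/
@[route_item "route-ValiantsHypothesis-VPBoundarySquare", crux]
def BooleanNbDefinable : Prop :=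
  Literature.Computability.AlgebraicComplexity.VNPnbPFamSubsetVNP ℂ

/-- item stmt-ValiantsHypothesis-23488 · aside · rank 9 · closed · proved by Summit.ValiantsHypothesis.ValiantsHypothesis.Theorems.VPBoundarySquareNbTransferHolds.collapseDebordersPresentableOfGRH_holds (planner) · by planner
sources: arXiv:2406.06217, Thm. 4.10 (2) (p0017 L63–L103), Rem. 4.9, BhargavDwivediSaxena2024, Lemma 4.1 (p.13), §6 (p.16), Burgisser2000, Cor. 4.6
[aside · THEOREM — the attacked child P_ε = CollapseDebordersPresentable (item 23458) modulo GRH and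
ONE named 2024 fact (decomp lens-3 v7 «NB-TRANSFER»; kernel `collapseDebordersPresentable_of_ERH`,
Theorems/VPBoundarySquareNbTransfer, p752304)] ERH ∧ Bürgisser 2024 Thm 4.10(2) ('over any field of
characteristic zero, assuming GRH, VP = VNP ⟺ VPnb = VNPnb'; 'the assertion (2) appears to be new';
proof outline via Bürgisser 2000 Cor 4.6 = GRH-Boolean parts of VP = VNP, tree named fact
`PPoly_eq_polyAdvice_NP_of_VP_eq_VNP`, plus the counting-hierarchy computation of
binomial-coefficient bits [buerg:09]; tree named fact `Bur24_thm_4_10_2`, p751938) ⟹ (VP = VNP ⟹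
every p-family with p-bounded PRESENTABLE border complexity is p-computable). CHAIN: VP̄_ε ∩ p-fam ⊆
VNPnb^ℂ (THEOREM A = BDS24 Lemma 4.1 in characteristic zero, exponential interpolation at 2^t-th
roots of unity indexed in binary: `IsPresVPBarFamily.isVNPnbFamily`, p751795) ⊆ VPnb (the fact,
under the collapse) and VPnb ∩ p-fam = VP (`isVPnbFamily_iff_isPComputable`). CONSEQUENCES (same
Theorems file): under ERH ∧ fact the route's open content is EmptyBoundarySeparates ∧
PresentableCompletion (`valiant_of_ERH_of_Q_of_complet -/
@[route_item "route-ValiantsHypothesis-VPBoundarySquare"]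
def CollapseDebordersPresentableOfGRH : Prop :=
  Literature.NumberTheory.LFunctions.ExtendedRiemannHypothesis → Literature.Computability.AlgebraicComplexity.Bur24_thm_4_10_2 ℂ → CollapseDebordersPresentable

-- `CollapseDebordersPresentableOfGRH` holds: proved by `Summit.ValiantsHypothesis.ValiantsHypothesis.Theorems.VPBoundarySquareNbTransferHolds.collapseDebordersPresentableOfGRH_holds` (its module imports this route file, so no `_holds` link can be stated here).

/-- item stmt-ValiantsHypothesis-23844 · aside · rank 9 · open · by planner
sources: arXiv:1605.02815, arXiv:2406.06217
[support] U (road of P, banked; OPEN in print: "not even known if closure(VP) ⊆ VNP", GMQ16 p.3) —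
every p-family with p-bounded border circuit complexity is in VNP. Implies P
(`p_of_closureDefinable`); with M implies S (`valiant_of_boundaryNonempty_of_closureDefinable`); not
known to imply S (compatible with VP = VNP = closure(VP)). [difficulty: open-problem] -/
@[route_item "route-ValiantsHypothesis-VPBoundarySquare", crux]
def ClosureDefinable : Prop :=
  ∀ (v : ℕ → ℕ) (f : ∀ n, MvPolynomial (Fin (v n)) ℂ), Literature.Computability.AlgebraicComplexity.IsPFamily f → Literature.Computability.AlgebraicComplexity.IsVPBarFamily f → Literature.Computability.AlgebraicComplexity.IsVNPFamily f

/-- item stmt-ValiantsHypothesis-23845 · aside · rank 9 · open · by planner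
sources: arXiv:1605.02815, arXiv:2510.13049
[support] M (road of Q, banked; the [GCT5] conjecture "closure(VP) ⊄ VP" studied in GMQ16) — some
p-family with p-bounded border circuit complexity is not p-computable. Implies Q trivially; with U
implies S; STRONGER than Q, not a piece. [difficulty: open-problem] -/
@[route_item "route-ValiantsHypothesis-VPBoundarySquare"]
def BoundaryOfVPNonempty : Prop :=
  ¬ ∀ (v : ℕ → ℕ) (f : ∀ n, MvPolynomial (Fin (v n)) ℂ), Literature.Computability.AlgebraicComplexity.IsPFamily f → Literature.Computability.AlgebraicComplexity.IsVPBarFamily f → Literature.Computability.AlgebraicComplexity.IsPComputable f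

/-- item stmt-ValiantsHypothesis-24720 · aside · rank 9 · open · by planner
sources: arXiv:2406.06217, §4.2, Thm. 4.10 (2), BhargavDwivediSaxena2024, Lemma 4.1 (p.13), §6 (p.16), arXiv:2606.25121, §4 p.11 (VNPnb⁰ not known closed under coefficients)
[aside · U_nb — rung of the COMPLETION LADDER of the theorem-input child PresentableCompletion
(decomp lens-3 v8 «NB/CH-COMPLETION»)] Every p-family with p-bounded border complexity is a
p-bounded Boolean sum of p-size circuits of unbounded degree over ℂ: VP̄ ∩ p-fam ⊆ VNPnb^ℂ
(Bürgisser 2024 §4.2 class VNPnb, tree `IsVNPnbFamily`). PLACE IN THE LADDER (tree theorems,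
Theorems/VPBoundarySquareCompletionLadder): PresentableCompletion (23459) ⟹ U_nb
(`nbClosureDefinable_of_presentableCompletion`, through A = BDS24 Lemma 4.1 in char 0,
`IsPresVPBarFamily.isVNPnbFamily`, p751795); U = ClosureDefinable ⟹ U_nb (VNP ⊆ VNPnb); U_nb ∧
B_nb(23487) ⟹ U; and U_nb is EXACTLY what the GRH-collapse lever needs: GLUE
`collapseEmptiesBoundary_of_nb : U_nb → P_nb → CollapseEmptiesBoundary` with P_nb =
`CollapseDebordersNb` (a cite-free def of Theorems/VPBoundarySquareCompletionLadder) a THEOREM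
modulo {ERH, Bur24_thm_4_10_2} (`collapseDebordersNb_of_ERH`), whence
`valiant_of_ERH_of_Q_of_nbCompletion : ERH → Bur24_thm_4_10_2 ℂ → EmptyBoundarySeparates → U_nb →
ValiantsHypothesis` and the witness form `valiant_of_ERH_of_nbWitness` (one p-family in VNPnb ∖ VP
proves VP ≠ VNP under GRH). TAG: WEAKER tha -/
@[route_item "route-ValiantsHypothesis-VPBoundarySquare", crux]
def NbClosureDefinable : Prop :=
  ∀ (v : ℕ → ℕ) (f : ∀ n, MvPolynomial (Fin (v n)) ℂ), Literature.Computability.AlgebraicComplexity.IsPFamily f → Literature.Computability.AlgebraicComplexity.IsVPBarFamily f → Literature.Computability.AlgebraicComplexity.IsVNPnbFamily f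

/-- item stmt-ValiantsHypothesis-24721 · aside · rank 9 · open · by planner
sources: arXiv:2606.25121, Def. 4.2, Cor. 4.4, Cor. 4.10, Cor. 4.12 (pp.11–14), KoiranPerifel2011, arXiv:2406.06217, §4.2–4.3, GMQ16, Question 4.44
[aside · U_CH — TOP rung of the completion ladder: the weakest completion hypothesis through which
the collapse lever still bites (decomp lens-3 v8 «NB/CH-COMPLETION»)] Every p-family with p-bounded
border complexity over ℂ is a specialisation, at polynomially many complex constants κ_n, of an
integer family (Q_n) in Bürgisser's algebraic counting class VCH⁰ (arXiv:2606.25121 Def 4.2: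
exponential format, coefficient function in CH/poly; tree `IsVCH0Family`,
Literature/…/Bur26CountingClassVCH, p754402): 'VP̄ ∩ p-fam ⊆ VCH^ℂ'. LADDER
(Theorems/VPBoundarySquareCompletionLadder): PresentableCompletion ⟹ U_nb ⟹ U_CH (VNPnb^ℂ ⊆ VCH^ℂ:
generic computation + Bur26 Cor 4.10 VNPnb⁰ ⊆ VCH⁰) ⟹ 'VP̄ ∩ p ⊆ VPSPACE^ℂ' (Cor 4.10, CH ⊆ PSPACE)
— and the collapse de-borders exactly up to this rung: VP = VNP ∧ GRH ⟹ PP ⊆ P/poly (Bürgisser 2000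
Cor 1.2, tree THEOREM `PP_subset_PPoly_of_VP_eq_VNP`) ⟹ CH ⊆ P/poly (tree
`CH_subset_PPoly_of_PP_subset_PPoly_holds`) ⟹ VCH-coefficient functions in P/poly ⟹ (Valiant's
criterion + Lemma 4.11 binary model x_{i,j} ↦ x_i^{2^j}, y_ℓ ↦ 2^{2^ℓ}) VCH^ℂ ∩ p-fam ⊆ VP (=
`CollapseDebordersCH`, def in Theorems/VPBoundarySquareCompletionLadder); one rung higher (VPSPACE) -/
@[route_item "route-ValiantsHypothesis-VPBoundarySquare", crux]
def CHClosureDefinable : Prop :=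
  ∀ (v : ℕ → ℕ) (f : ∀ n, MvPolynomial (Fin (v n)) ℂ), Literature.Computability.AlgebraicComplexity.IsPFamily f → Literature.Computability.AlgebraicComplexity.IsVPBarFamily f → ∃ (w : ℕ → ℕ) (Q : ∀ n, MvPolynomial (Fin (v n + w n)) ℤ) (κ : ∀ n, Fin (w n) → ℂ), Literature.Computability.AlgebraicComplexity.IsVCH0Family Q ∧ ∀ n, f n = MvPolynomial.aeval (Fin.append MvPolynomial.X fun j => MvPolynomial.C (κ n j)) (MvPolynomial.map (Int.castRingHom ℂ) (Q n))

/-- item stmt-ValiantsHypothesis-23848 · assembly · rank 1 · closed · proved by Summit.ValiantsHypothesis.ValiantsHypothesis.Theorems.VPBoundarySquareAssembly.assembly_holds (planner) · by planner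
sources: BurgisserEtAl2011
[assembly] Q → P → VP_ℂ ≠ VNP_ℂ. -/
@[route_item "route-ValiantsHypothesis-VPBoundarySquare"]
def Assembly : Prop :=
  EmptyBoundarySeparates → CollapseEmptiesBoundary → ValiantsHypothesis

-- `Assembly` holds: proved by `Summit.ValiantsHypothesis.ValiantsHypothesis.Theorems.VPBoundarySquareAssembly.assembly_holds` (its module imports this route file, so no `_holds` link can be stated here).

/-! D-0027 §2.1 — DECIDING THEOREM (planner-authored via `route open/edit --closes-file`; by planner-decomp-val-lens-3-g4-0 2026-08-29T22:18:06Z):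
its hypotheses are this route's items and its conclusion the sub-problem Statement (glue_lint), and it elaborates with this file. -/

@[closes "route-ValiantsHypothesis-VPBoundarySquare"] theorem closes (h₁ : EmptyBoundarySeparates) (h₂ : CollapseEmptiesBoundary) : ValiantsHypothesis := by
  change Literature.Computability.AlgebraicComplexity.VP ℂ ≠
    Literature.Computability.AlgebraicComplexity.VNP ℂ
  intro hEq
  refine h₁ (h₂ hEq) ?_
  intro v f hf
  have hVNP : Literature.Computability.AlgebraicComplexity.PolyFamily.ofFintype f ∈
      Literature.Computability.AlgebraicComplexity.VNP ℂ :=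
    (Literature.Computability.AlgebraicComplexity.mem_VNP_ofFintype_iff_holds f).2 hf
  have hVP : Literature.Computability.AlgebraicComplexity.PolyFamily.ofFintype f ∈
      Literature.Computability.AlgebraicComplexity.VP ℂ := by
    rw [hEq]; exact hVNP
  exact ((Literature.Computability.AlgebraicComplexity.mem_VP_ofFintype_iff_holds f).1 hVP).2.mono
    fun n => Literature.Computability.AlgebraicComplexity.approxComplexity_le_complexity (f n)

end Summit.ValiantsHypothesis.ValiantsHypothesis.Theses.VPBoundarySquare
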